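import Mathlib
import Summits.Ventures.PercRepro.TriangleCapTriangleFreeThreeC

/-!
# PercRepro — THREE BELOW THE DIAGONAL ON TRIANGLE-FREE GRAPHS, PART D: the theorems (p3, gen 36; part 43)

* **`triangle_free_stability_three`** — a triangle-free graph on `k` vertices with `m ≥ 2k − 3` edges that is not
  bipartite spanning with `≤ 2` missing cross pairs has `Σ_v d(v)² + 3 (k − 4) ≤ m·k`: bipartite spanning ⇒ `N₀ ≥ 3`
  ⇒ TriangleCapBipartiteThree; otherwise a vertex of degree `≥ 4` exists for `k ≥ 7` (`2m > 3k`) and the `r = 3`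
  core applies, while `k ≤ 6` is the `r = 2` core (`4 (k − 3) ≥ 6 (k − 4)`);
* **`three_below_diagonal_cliqueFree_exact`** — for `1 ≤ a`, `a + 3 ≤ k`, `m = a(k − a) − 3 ≥ 2k − 3` with `m`, `m + 1`,
  `m + 2` not of the form `a′(k − a′)`: the maximum of `2·Σ_v C(d(v), 2)` over the TRIANGLE-FREE graphs on `Fin k` with
  `m` edges IS `m (k − 2) − 3 (k − 4)`, by `K_{a, k−a}` minus three edges at one vertex — the sub-diagonal `r = 3` of the
  closed form P3-TRIANGLE-CAP.md §10av on the triangle-free class: `(9,15) 45 · (10,18) 63 · (11,21) 84 · (12,24) 108 ·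
  (13,27) 135`.
Axioms: standard.
-/

namespace PercRepro

namespace TriangleCap

namespace C047

open Finset

variable {V : Type*} [Fintype V] [DecidableEq V]

omit [DecidableEq V] in
/-- A graph with `2k ≤ m + 3` and `k ≥ 7` has a vertex of degree `≥ 4`. -/
theorem exists_deg_four_of_dense (D : SimpleGraph V) [DecidableRel D.Adj] (hk : 7 ≤ Fintype.card V)
    (hm : 2 * Fintype.card V ≤ D.edgeFinset.card + 3) : ∃ u, 4 ≤ deg D u := by
  by_contra h
  have h1 : ∀ u ∈ (univ : Finset V), deg D u ≤ 3 := fun u _ => by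
    by_contra h'
    exact h ⟨u, by omega⟩
  have h2 := sum_le_sum h1
  rw [sum_deg_eq, sum_const, smul_eq_mul, card_univ] at h2
  omega

/-- **THREE BELOW THE DIAGONAL, TRIANGLE-FREE:** a triangle-free graph on `k` vertices with `m ≥ 2k − 3` edges that
is not bipartite spanning with at most two missing cross pairs has `Σ_v d(v)² + 3 (k − 4) ≤ m·k`. -/
theorem triangle_free_stability_three (D : SimpleGraph V) [DecidableRel D.Adj] (hfree : D.CliqueFree 3)
    (hm : 2 * Fintype.card V ≤ D.edgeFinset.card + 3)
    (hnot : ¬ ∃ A : Finset V, (∀ x y, D.Adj x y → (x ∈ A ↔ y ∉ A)) ∧ (missing D A Aᶜ).card ≤ 2) :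
    ∑ v, deg D v * deg D v + 3 * (Fintype.card V - 4) ≤ D.edgeFinset.card * Fintype.card V := by
  by_cases hb : ∃ A : Finset V, ∀ x y, D.Adj x y → (x ∈ A ↔ y ∉ A)
  · obtain ⟨A, hA⟩ := hb
    have hN : 3 ≤ (missing D A Aᶜ).card := by
      by_contra h
      exact hnot ⟨A, hA, by omega⟩
    exact bipartite_stability_three D A hA hN hm
  · have hid := two_mul_sum_deg_sq_add_sum_deficit D
    rw [card_triangles3_eq_zero_of_cliqueFree D hfree] at hid
    have hid2 : 2 * ∑ v, deg D v * deg D v + ∑ p ∈ adjPairsAll D, deficit D p =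
        2 * (D.edgeFinset.card * Fintype.card V) := by rw [hid]; ring
    by_cases hk : Fintype.card V ≤ 6
    · by_cases hk3 : Fintype.card V ≤ 3
      · have : Fintype.card V - 4 = 0 := by omega
        rw [this]
        omega
      · obtain ⟨u, hu⟩ := exists_deg_two_of_dense D (by omega) hm
        have hne : (univ.filter (fun w => D.Adj u w)).Nonempty := by
          apply card_pos.mp
          show 0 < deg D u
          omega
        obtain ⟨v, hv⟩ := hne
        rw [mem_filter] at hv
        have := four_mul_le_sum_deficit_of_not_bipartite D hfree hv.2 hu hb
        omega
    · obtain ⟨u, hu⟩ := exists_deg_four_of_dense D (by omega) hm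
      have hne : (univ.filter (fun w => D.Adj u w)).Nonempty := by
        apply card_pos.mp
        show 0 < deg D u
        omega
      obtain ⟨v, hv⟩ := hne
      rw [mem_filter] at hv
      have := six_mul_le_sum_deficit_of_not_bipartite D hfree hv.2 hu hb
      omega

/-- `triangle_free_stability_three` in cherries: `2·Σ_v C(d(v), 2) + 2m + 3 (k − 4) ≤ m·k`. -/
theorem triangle_free_stability_three_cherries (D : SimpleGraph V) [DecidableRel D.Adj] (hfree : D.CliqueFree 3)
    (hm : 2 * Fintype.card V ≤ D.edgeFinset.card + 3)
    (hnot : ¬ ∃ A : Finset V, (∀ x y, D.Adj x y → (x ∈ A ↔ y ∉ A)) ∧ (missing D A Aᶜ).card ≤ 2) :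
    2 * cherries D + 2 * D.edgeFinset.card + 3 * (Fintype.card V - 4) ≤
      D.edgeFinset.card * Fintype.card V := by
  have h1 := triangle_free_stability_three D hfree hm hnot
  have h2 := two_mul_cherries_add D
  have h3 := sum_deg_eq D
  omega

/-- **THREE BELOW THE DIAGONAL, TRIANGLE-FREE, EXACT:** for `1 ≤ a`, `a + 3 ≤ k`, `m = a(k − a) − 3 ≥ 2k − 3` with
`m`, `m + 1`, `m + 2` not of the form `a′(k − a′)`, the maximum of `2·Σ_v C(d(v), 2)` over the triangle-free graphs
on `Fin k` with `m` edges is `m (k − 2) − 3 (k − 4)`, attained by `K_{a, k−a}` minus three edges at one vertex. -/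
theorem three_below_diagonal_cliqueFree_exact (k a : ℕ) (ha : 1 ≤ a) (hak : a + 3 ≤ k)
    (hdense : 2 * k ≤ a * (k - a) - 3 + 3)
    (hm : ∀ a', a' ≤ k → a * (k - a) - 3 ≠ a' * (k - a') ∧ a * (k - a) - 2 ≠ a' * (k - a') ∧
      a * (k - a) - 1 ≠ a' * (k - a')) :
    (∀ (D : SimpleGraph (Fin k)) [DecidableRel D.Adj], D.CliqueFree 3 →
        D.edgeFinset.card = a * (k - a) - 3 →
        2 * cherries D + 3 * (k - 4) ≤ (a * (k - a) - 3) * (k - 2)) ∧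
      ∃ (D : SimpleGraph (Fin k)) (_ : DecidableRel D.Adj), D.CliqueFree 3 ∧
        D.edgeFinset.card = a * (k - a) - 3 ∧ 2 * cherries D + 3 * (k - 4) = (a * (k - a) - 3) * (k - 2) := by
  have hka : 3 ≤ a * (k - a) := by
    obtain ⟨c, hc⟩ : ∃ c, k = a + 3 + c := ⟨k - a - 3, by omega⟩
    subst hc
    have : a + 3 + c - a = 3 + c := by omega
    rw [this]
    nlinarith
  obtain ⟨m, hmm⟩ : ∃ m, a * (k - a) = m + 3 := ⟨a * (k - a) - 3, by omega⟩
  have e1 : a * (k - a) - 3 = m := by omega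
  have e2 : a * (k - a) - 2 = m + 1 := by omega
  have e3 : a * (k - a) - 1 = m + 2 := by omega
  rw [e1] at hdense hm ⊢
  rw [e2, e3] at hm
  constructor
  · intro D _ hfree hD
    have hcard : Fintype.card (Fin k) = k := Fintype.card_fin k
    have hnot : ¬ ∃ A : Finset (Fin k), (∀ x y, D.Adj x y → (x ∈ A ↔ y ∉ A)) ∧ (missing D A Aᶜ).card ≤ 2 := by
      rintro ⟨A, hA, hN⟩
      have hNX := card_missing_add_card_edges D A hA
      have hXc : Aᶜ.card = k - A.card := by
        have := card_add_card_compl A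
        rw [hcard] at this
        omega
      have hXk : A.card ≤ k := by
        have := card_le_univ A
        rwa [hcard] at this
      obtain ⟨h1, h2, h3⟩ := hm A.card hXk
      rw [hXc, hD] at hNX
      have : (missing D A Aᶜ).card = 0 ∨ (missing D A Aᶜ).card = 1 ∨ (missing D A Aᶜ).card = 2 := by omega
      rcases this with h | h | h
      · rw [h] at hNX; exact h1 (by omega)
      · rw [h] at hNX; exact h2 (by omega)
      · rw [h] at hNX; exact h3 (by omega)
    have := triangle_free_stability_three_cherries D hfree (by rw [hcard, hD]; exact hdense) hnot
    rw [hcard, hD] at this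
    obtain ⟨k', hk'⟩ : ∃ k', k = k' + 4 := ⟨k - 4, by omega⟩
    subst hk'
    have e4 : k' + 4 - 4 = k' := by omega
    have e5 : k' + 4 - 2 = k' + 2 := by omega
    rw [e4] at this ⊢
    rw [e5]
    nlinarith
  · refine ⟨bipMinusStar k a 3, inferInstance,
      cliqueFree_of_bipartite _ (univ.filter (fun i : Fin k => i.val < a)) (bipMinusStar_bipartite k a 3), ?_, ?_⟩
    · have := card_edges_bipMinusStar k a 3 ha hak
      omega
    · have h := two_mul_cherries_bipMinusStar k a 3 ha hak (by omega)
      rw [hmm] at h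
      obtain ⟨k', hk'⟩ : ∃ k', k = k' + 4 := ⟨k - 4, by omega⟩
      subst hk'
      have e4 : k' + 4 - 4 = k' := by omega
      have e5 : k' + 4 - 2 = k' + 2 := by omega
      have e6 : 2 * (k' + 4) - 3 - 3 = 2 * k' + 2 := by omega
      rw [e5, e6] at h
      rw [e4, e5]
      nlinarith

end C047

end TriangleCap

end PercRepro
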